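import Summits.CriticalPhenomena.PercolationContinuityZ3.Theorems.PercNearOneGluingNoHeavyPcintBSMXTail
import Summits.CriticalPhenomena.PercolationContinuityZ3.Theorems.PercNearOneGluingNoHeavyPcintBSMCompute
import HarnessLib

/-!
# PCINT lane, PHASE 6 (block renewal with reach-two pieces): tail bounds from `ℚ` data

Cell `prim-pcint`, seat `prim-pcint-1` (gen 15); memo `run/shared/lean/prim/pcint/T-FIBRE-ROUTE.md` §PHASE 6.

The analytic tail bounds of …PcintBSMXTail (`BSMX.tailBound_two` for two time axes, `BSMX.tailBound_three` for
`k ≥ 3`) discharged from decidable `ℚ` inequalities on the kernel data: the five-point law `(A₀, A₁, A₂)/DA`, the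
exact oriented meeting probability `u k N` read from the tree's table `OSM.vrow` (`BSM.uqv`), and the balanced
multinomial probability as a rational (`BSMX.BQ`, cast `OSM.B`).  **`BSMX.tailBoundH_of_twoQ`**,
**`BSMX.tailBoundH_of_threeQ`**: the tail `Tn/DG` of the instance files.
-/

noncomputable section

namespace Summit.CriticalPhenomena.PercolationContinuityZ3.Theorems.Pcint.BSMX

open Finset OSM BSM

variable {t k : ℕ}

/-- The admissible parameters from the law numerators. -/
theorem adm_of_nat {A0 A1 A2 DA : ℕ} (hDA : A0 + 2 * A1 + 2 * A2 = DA) (hA1 : 0 < A1) (hA4 : 4 * A1 + 2 * A2 ≤ DA) :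
    Adm ((A1 : ℝ) / DA) ((A2 : ℝ) / DA) := by
  have hDA0 : 0 < DA := by rw [← hDA]; omega
  have hDAR : (0 : ℝ) < DA := by exact_mod_cast hDA0
  refine ⟨by positivity, by positivity, ?_⟩
  have : (4 * A1 + 2 * A2 : ℝ) ≤ DA := by exact_mod_cast hA4
  rw [show 4 * ((A1 : ℝ) / DA) + 2 * ((A2 : ℝ) / DA) = (4 * A1 + 2 * A2) / DA by ring, div_le_one hDAR]
  exact this

/-- **The two-time-axes tail from a kernel check**: `u 2 N (2N+2) / ((2N+1) 4a₁) ≤ Tn/DG` in cleared form. -/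
theorem tailBoundH_of_twoQ (ht : 2 ≤ t) {A0 A1 A2 DA : ℕ} (hDA : A0 + 2 * A1 + 2 * A2 = DA) (hA1 : 0 < A1)
    (hA4 : 4 * A1 + 2 * A2 ≤ DA) (N : ℕ) {Tn DG : ℕ} (hDG : 0 < DG)
    (h : uqv (OSM.vrow 2 N) 2 N * (2 * (N : ℚ) + 2) * DG * DA ≤ (Tn : ℚ) * (2 * (N : ℚ) + 1) * (4 * A1)) :
    TailBoundH t 2 ((A1 : ℝ) / DA) ((A2 : ℝ) / DA) N ((Tn : ℝ) / DG) := by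
  have hadm := adm_of_nat hDA hA1 hA4
  have hDAR : (0 : ℝ) < DA := by exact_mod_cast (by omega : 0 < DA)
  have hDGR : (0 : ℝ) < DG := by exact_mod_cast hDG
  have hA1R : (0 : ℝ) < A1 := by exact_mod_cast hA1
  refine tailBound_two hadm ht N ?_
  have h' := (Rat.cast_le (K := ℝ)).2 h
  push_cast at h'
  rw [uqv_cast le_rfl] at h'
  have hu := u_nonneg (d := 2) N
  rw [div_le_div_iff₀ (by positivity) hDGR]
  calc u 2 N * (2 * (N : ℝ) + 2) * DG = u 2 N * (2 * (N : ℝ) + 2) * DG * DA / DA := by field_simp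
    _ ≤ (Tn : ℝ) * (2 * (N : ℝ) + 1) * (4 * A1) / DA := div_le_div_of_nonneg_right h' hDAR.le
    _ = (Tn : ℝ) * ((2 * (N : ℝ) + 1) * (4 * ((A1 : ℝ) / DA))) := by field_simp

/-- The balanced multinomial probability over `ℚ`: `(q k)! / (q!^k k^{q k})`. -/
def BQ (k q : ℕ) : ℚ := ((Nat.factorial (q * k) : ℕ) : ℚ) / ((((Nat.factorial q) ^ k : ℕ) : ℚ) * (((k ^ (q * k)) : ℕ) : ℚ))

/-- `BQ` casts to `OSM.B`. -/
theorem BQ_cast (k q : ℕ) : ((BQ k q : ℚ) : ℝ) = B k q := by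
  unfold BQ OSM.B
  push_cast
  ring

/-- **The `k ≥ 3` tail from a kernel check**: `k B k q₀ (q₀+1) / (8 a₁ N) ≤ Tn/DG` in cleared form. -/
theorem tailBoundH_of_threeQ (hk : 3 ≤ k) (ht : 2 ≤ t) {A0 A1 A2 DA : ℕ} (hDA : A0 + 2 * A1 + 2 * A2 = DA)
    (hA1 : 0 < A1) (hA4 : 4 * A1 + 2 * A2 ≤ DA) {q₀ N : ℕ} (hN : q₀ * k ≤ N) (hN1 : 1 ≤ N) {Tn DG : ℕ} (hDG : 0 < DG)
    (h : (k : ℚ) * BQ k q₀ * ((q₀ : ℚ) + 1) * DG * DA ≤ (Tn : ℚ) * 8 * A1 * N) :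
    TailBoundH t k ((A1 : ℝ) / DA) ((A2 : ℝ) / DA) N ((Tn : ℝ) / DG) := by
  have hadm := adm_of_nat hDA hA1 hA4
  have hDAR : (0 : ℝ) < DA := by exact_mod_cast (by omega : 0 < DA)
  have hDGR : (0 : ℝ) < DG := by exact_mod_cast hDG
  have hA1R : (0 : ℝ) < A1 := by exact_mod_cast hA1
  have hNR : (0 : ℝ) < N := by exact_mod_cast hN1
  refine tailBound_three hadm hk ht hN hN1 ?_
  have h' := (Rat.cast_le (K := ℝ)).2 h
  push_cast at h'
  rw [BQ_cast] at h'
  unfold Cu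
  rw [div_le_div_iff₀ (by positivity) hDGR]
  calc (k : ℝ) * B k q₀ * ((q₀ : ℝ) + 1) * DG = (k : ℝ) * B k q₀ * ((q₀ : ℝ) + 1) * DG * DA / DA := by field_simp
    _ ≤ (Tn : ℝ) * 8 * A1 * N / DA := div_le_div_of_nonneg_right h' hDAR.le
    _ = (Tn : ℝ) * (8 * ((A1 : ℝ) / DA) * N) := by field_simp

end Summit.CriticalPhenomena.PercolationContinuityZ3.Theorems.Pcint.BSMX

end
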